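import Summits.CriticalPhenomena.SAWScalingLimit.Theorems.SAWDefectDecoherenceObservableToSLERNestedGateDefs
import HarnessLib

/-!
# The middle section of the self-avoiding walk between its two first good gates avoids both
# removed levels (piece (T-A′ link-a) of stub T-A′ `stub_carvedReduction_squeezeGeometry_domains`)

Crux `SAWDevelopingMap.ObservableToSLE` (stmt-CriticalPhenomena-10472), line `six-class-type-ladder`,
stub T-A′ `stub_carvedReduction_squeezeGeometry_domains`.  Landing target:
`Summits/CriticalPhenomena/SAWScalingLimit/Theorems/SAWDevelopingMapObservableToSLETypeLadderCarvedReductionSqueezeMiddleWalk.lean`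
(`--supports stmt-CriticalPhenomena-10472`; registered carrier `stub_carvedReduction_middleWalk`).

The bulk LINK of the framed super-domain (hypothesis `JoinedIn …` of
`stub_carvedReduction_superFrame`) is the pinned polyline of a lattice walk from the gate `q` to
the gate `q'` avoiding the removed set `S(n) ∪ T(n')`.  Such a walk is read off the realised
self-avoiding walk `γ` of the hypothesis `hgates`: its list of vertices `l` first leaves `S(n)`
through `{p, q}` at index `m` and never returns (`IsFirstGoodGateN … l n m p q`), and the reversed
list first leaves `T(n')` through `{p', q'}` at index `m'` and never returns.  This file is the
list/walk combinatorics (`exists_middleWalk`, registered as `stub_carvedReduction_middleWalk`): if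
moreover `q' ∉ S(n)` (in the squeeze: `S(n)` lies within `R` of the far root), the sub-walk of the
walk from position `m` to position `length - 1 - m'` runs from `q` to `q'` and all its vertices lie
off `S(n)` and off `T(n')`.
-/

noncomputable section

open Filter Set
open Literature.Probability.LatticeModels (HexVertex)

namespace Summit.CriticalPhenomena.SAWScalingLimit.Theorems.ObservableToSLE.TypeLadder

open Summit.CriticalPhenomena.SAWScalingLimit.Theorems.ObservableToSLER.NestedGate (IsFirstExitFrom)

/-- **The middle section of a walk between two first exits.**  Let `w` be a walk with vertex list
`l`, `l` first leaving `S` at index `m` through `{p, q}` and staying off `S` afterwards, and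
`l.reverse` first leaving `T` at index `m'` through `{p', q'}` and staying off `T` afterwards.  If
`q' ∉ S`, there is a sub-walk from `q` to `q'` all of whose vertices are vertices of `w` off `S`
and off `T`. -/
theorem exists_middleWalk {G : SimpleGraph HexVertex} {a b : HexVertex} (w : G.Walk a b) {S T : Set HexVertex}
    {m m' : ℕ} {p q p' q' : HexVertex} (hS : IsFirstExitFrom S w.support m p q)
    (hSno : ∀ v ∈ w.support.drop m, v ∉ S) (hT : IsFirstExitFrom T w.support.reverse m' p' q')
    (hTno : ∀ v ∈ w.support.reverse.drop m', v ∉ T) (hq' : q' ∉ S) :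
    ∃ w' : G.Walk q q', ∀ v ∈ w'.support, v ∈ w.support ∧ v ∉ S ∧ v ∉ T := by
  classical
  set l : List HexVertex := w.support with hl
  have hlen : l.length = w.length + 1 := w.length_support
  -- the positions of `q` and `q'`
  obtain ⟨-, hq, hStake, -⟩ := hS
  obtain ⟨-, hq'r, -, -⟩ := hT
  rw [List.head?_drop] at hq hq'r
  obtain ⟨hm, hlm⟩ := List.getElem?_eq_some_iff.1 hq
  have hm' : m' < l.length := by
    by_contra hcon
    push Not at hcon
    have : l.reverse[m']? = none := List.getElem?_eq_none (by rw [List.length_reverse]; exact hcon)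
    rw [this] at hq'r
    exact absurd hq'r (by simp)
  rw [List.getElem?_reverse hm'] at hq'r
  obtain ⟨hi', hli'⟩ := List.getElem?_eq_some_iff.1 hq'r
  set i' : ℕ := l.length - 1 - m' with hi'def
  -- order of the two positions
  have hmi' : m ≤ i' := by
    by_contra hcon
    push Not at hcon
    refine hq' (hStake q' ?_)
    rw [List.mem_take_iff_getElem]
    exact ⟨i', by rw [Nat.lt_min]; exact ⟨hcon, hi'⟩, hli'⟩
  -- the sub-walk from position `m` to position `i'`
  have hmlen : m ≤ w.length := by rw [hlen] at hm; omega
  have hi'len : i' ≤ w.length := by rw [hlen] at hi'; omega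
  have hgm : w.getVert m = q := by
    rw [w.getVert_eq_support_getElem hmlen]; exact hlm
  have hgi' : w.getVert i' = q' := by
    rw [w.getVert_eq_support_getElem hi'len]; exact hli'
  set w₂ := (w.drop m).take (i' - m) with hw₂
  have hend : (w.drop m).getVert (i' - m) = q' := by
    rw [w.drop_getVert, Nat.add_sub_cancel' hmi', hgi']
  refine ⟨w₂.copy hgm hend, fun v hv => ?_⟩
  rw [SimpleGraph.Walk.support_copy, hw₂, SimpleGraph.Walk.support_take,
    SimpleGraph.Walk.drop_support_eq_support_drop_min, min_eq_left hmlen] at hv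
  -- `v = l[m + j]` with `m + j ≤ i'`
  rw [List.mem_take_iff_getElem] at hv
  obtain ⟨j, hj, hjv⟩ := hv
  rw [Nat.lt_min] at hj
  rw [List.getElem_drop] at hjv
  have hidx : m + j < l.length := by
    have := hj.2; rw [List.length_drop] at this; omega
  have hvdrop : v ∈ l.drop m := by
    rw [List.mem_drop_iff_getElem]
    exact ⟨j, by omega, hjv⟩
  refine ⟨List.mem_of_mem_drop hvdrop, hSno v hvdrop, hTno v ?_⟩
  -- `v ∈ l.reverse.drop m' = (l.take (l.length - m')).reverse`
  rw [List.drop_reverse, List.mem_reverse, List.mem_take_iff_getElem]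
  refine ⟨m + j, ?_, hjv⟩
  rw [Nat.lt_min]
  exact ⟨by omega, hidx⟩

/-- **Registered carrier `stub_carvedReduction_middleWalk`** (crux item stmt-CriticalPhenomena-10472,
stub T-A′ `stub_carvedReduction_squeezeGeometry_domains`, piece THE MIDDLE SECTION OF THE SAW):
`exists_middleWalk` for the honeycomb domain graphs, quantified. -/
theorem stub_carvedReduction_middleWalk :
    ∀ (G : SimpleGraph HexVertex) (a b : HexVertex) (w : G.Walk a b) (S T : Set HexVertex) (m m' : ℕ)
      (p q p' q' : HexVertex),
      IsFirstExitFrom S w.support m p q → (∀ v ∈ w.support.drop m, v ∉ S) →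
      IsFirstExitFrom T w.support.reverse m' p' q' → (∀ v ∈ w.support.reverse.drop m', v ∉ T) → q' ∉ S →
      ∃ w' : G.Walk q q', ∀ v ∈ w'.support, v ∈ w.support ∧ v ∉ S ∧ v ∉ T :=
  fun _ _ _ w _ _ _ _ _ _ _ _ hS hSno hT hTno hq' => exists_middleWalk w hS hSno hT hTno hq'

end Summit.CriticalPhenomena.SAWScalingLimit.Theorems.ObservableToSLE.TypeLadder

end
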